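import Literature.NumberTheory.Rogawski1990.UnitFundamentalLemmaInertFlickerFrame     -- ★ p840795 (F0) FILE 1: the frame, `formCongr`, `Φ₃`
import Literature.NumberTheory.Rogawski1990.CartanInvariant                           -- ★ `twistGram`
import HarnessLib

/-!
# Flicker's torus elements `t_θ` in the `Φ₃`-frame: membership in `U(Φ₃)`, eigenframes, characteristic polynomial, the stable conjugators
# `diag(θ,1,1)`, `g₃`, `g₄`, and the eigenvector lengths of the four classes `t₁, t₂ = t_π, t₃, t₄` — sign vectors `(0,0,0), (1,0,1), (1,1,0), (0,1,1)`
# (Flicker 1998 §2 Prop. 3 pp. 78–79, §3 p. 80; Rogawski 1990 §3.5 Prop. 3.5.2, §3.6)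

Topic `NumberTheory/Rogawski1990`; namespace `Literature.NumberTheory.Rogawski1990`.  **Theorems only** (no `def`, no instance, no notation, no named
fact, no `sorry`); imports = tree.  Brick (F0) FILE 2 of the road «N7-ns COUNT FROM FLICKER» (LEAD F0P3a-plan T8-43; architect A-p06 «Φ₃-native»;
consumer's answers A-p03 (g24) 04:15:50Z: LITERALS, ring-generic): the objects of [Flicker1998UnitaryFL, Prop. 3 and §3] as MATRIX LITERALS over any
commutative ring, so that the congruence-volume bricks (F1)–(F8) (generic valued field `K`) and the junction (F12) (the CM carriers) both specialise them.

**The literals** (`e` with `2e = 1` plays `½`; `θ θ′ = 1`; `π π′ = 1`; `Φ₃ = antidiag(1,1,1)` written `(i,j) ↦ [i+j+1 = 3]`):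
* `t_θ(a,b,c) := !![e(a+c), 0, −e(a−c)θ; 0, b, 0; −e(a−c)θ′, 0, e(a+c)]` — Flicker's `t_θ = ((a+c)∕2, 0, (a−c)θ∕2; 0, b, 0; (a−c)∕(2θ), 0, (a+c)∕2)` (§3 p. 80)
  conjugated by `D = diag(1,1,−1)` into the tree's form `Φ₃` (★ `formCongr_signDiagonal_antidiagOne_eq_neg_flickerJ`); `t₁ = t_1`, `t₂ = t_π`;
  `t₃ := t_π(a,c,b)`, `t₄ := t_π(b,a,c)` (Prop. 3: `diag(a,c,b)`, `diag(b,a,c)`).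
* frames `P_θ := !![θ,0,θ; 0,1,0; −1,0,1]` (columns = eigenvectors for `a, b, c`; `b` on the middle line = the `U(1)`-slot), `P₃ := !![π,π,0; 0,0,1; −1,1,0]`,
  `P₄ := !![0,π,π; 1,0,0; 0,−1,1]`; conjugators `diag(θ,1,1)`, `g₃ := !![eπ, π, −eπ; e, 0, e; −e, 1, e] = P₃ P₁⁻¹`, `g₄ := !![eπ, π, eπ; e, 0, −e; e, −1, e] = P₄ P₁⁻¹`
  (`det g₃ = det g₄ = −π`).

**Contents.**
* §1 (commutative ring): `ᵗσ(t_θ) Φ₃ t_θ = Φ₃` (`flickerTorusElt_unitary`, `…_one_unitary`); `t_θ P_θ = P_θ diag(a,b,c)` (`flickerTorusElt_mul_frame`,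
  `…_one_mul_frame`); `det P_θ = 2θ`; `charpoly t_θ = (X−a)(X−b)(X−c)`; the conjugations `diag(θ,1,1) t₁ = t_θ diag(θ,1,1)`, `g₃ t₁ = t₃ g₃`, `g₄ t₁ = t₄ g₄` and
  frames `diag(θ,1,1) P₁ = P_θ`, `g₃ P₁ = P₃`, `g₄ P₁ = P₄`; the eigenvector LENGTHS `ᵗσP Φ₃ P`: `diag(−2θ, 1, 2θ)`, `diag(−2π, 2π, 1)`, `diag(1, −2π, 2π)`
  (`twistGram_flickerFrame`, `twistGram_frameThree`, `twistGram_frameFour`); and `twistGram σ J (T P) = twistGram σ (ᵗσT J T) P` (`twistGram_formCongr`: the frame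
  `e` of ★ FILE 1 preserves lengths on the nose).
* §2 (field, `π ∉ N = {σ(z) z}`, `2 = σ(x) x`, `−2 = σ(y) y` — Flicker's `x, y`, `E∕F` unramified, `p ≠ 2`): the NORM TESTS of ★ `LocalStableClassesNonsplitTypeOneCount`
  slot by slot against `P₁`: `t₁ ↦ (0,0,0)`, `t_π ↦ (1,0,1)`, `t₃ ↦ (1,1,0)`, `t₄ ↦ (0,1,1)` (`normTest_flickerFrame_one_iff`, `normTest_flickerFrame_pi_iff`,
  `normTest_frameThree_iff`, `normTest_frameFour_iff`).  In particular the middle (`U(1)`-)slot test PASSES on `t₁, t₂` and FAILS on `t₃, t₄` — the split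
  `Φ^κ = Φ(t₁) + Φ(t₂) − Φ(t₃) − Φ(t₄)` of [Flicker, p. 95] against ★ `LocalStableClassesNonsplitKappaCount`.

What is NOT here (FILE 3): the class-set identity `conjClassesIn σ_v Φ₃ ⟦t₁⟧ = {⟦t₁⟧, ⟦t_π⟧, ⟦t₃⟧, ⟦t₄⟧}` on the `LocalRing E v` carrier (★ `ncard_conjClassesIn_eq_four`
+ ★ `exists_unitary_conj_iff_forall_normTest_iff` + §2) and its one-place ∕ CM corollaries.

Proof technique: `ext i j; fin_cases` and per-entry `simp` + `grind` (Gröbner closure modulo `2e = 1`, `θθ′ = 1`, `σ(a)a = 1`, …).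

## References
* Y. Z. Flicker, *Elementary proof of the fundamental lemma for a unitary group*, Canad. J. Math. 50 (1998) 74–98, §2 Prop. 3 pp. 78–79 (`T₀, h, r, t₁…t₄`,
  `g₂ = r`, `g₃`, `g₄`, `x x̄ = 2`, `y ȳ = −2`), §3 p. 80 (`t_θ`, `θ ∈ {1, π}`), §5 p. 95 (`Φ^κ`) [Flicker1998UnitaryFL].
* J. Rogawski, *Automorphic Representations of Unitary Groups in Three Variables*, Ann. of Math. Stud. 123 (1990), §3.1 p. 19, §3.5 Prop. 3.5.2 (a)(c)
  p. 29, §3.6 p. 31 [Rogawski1990].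
-/

set_option autoImplicit false

noncomputable section

open Matrix
open scoped MatrixGroups

namespace Literature.NumberTheory.Rogawski1990

open Literature.NumberTheory.Automorphic
open Literature.AlgebraicGeometry.ShimuraVarieties (unitaryGroup)

/-! ## §1 Ring identities (any commutative ring; `e = ½`, `θ θ′ = 1`, `π π′ = 1`) -/

section Ring

variable {R : Type*} [CommRing R] (σ : R →+* R)

/-- **`t_θ ∈ U(σ, Φ₃)`**: Flicker's `t_θ = D · ((a+c)∕2, 0, (a−c)θ∕2; 0, b, 0; (a−c)∕(2θ), 0, (a+c)∕2) · D` (`D = diag(1,1,−1)`, the `Φ₃`-native copy)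
satisfies `ᵗσ(t_θ) Φ₃ t_θ = Φ₃` whenever `σ(a)a = σ(b)b = σ(c)c = 1`, `θ, θ′ = θ⁻¹` and `e = ½` are `σ`-fixed.
[cite: Flicker1998UnitaryFL, §2 Prop. 3 pp. 78–79; §3 p. 80] -/
theorem flickerTorusElt_unitary {e θ θ' a b c : R} (h2 : 2 * e = 1) (hθ : θ * θ' = 1) (hσe : σ e = e) (hσθ : σ θ = θ)
    (hσθ' : σ θ' = θ') (ha : σ a * a = 1) (hb : σ b * b = 1) (hc : σ c * c = 1) :
    ((!![e * (a + c), 0, -(e * (a - c) * θ); 0, b, 0; -(e * (a - c) * θ'), 0, e * (a + c)]).map σ)ᵀ *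
        (Matrix.of fun i j : Fin 3 => if i.val + j.val + 1 = 3 then (1 : R) else 0) *
        !![e * (a + c), 0, -(e * (a - c) * θ); 0, b, 0; -(e * (a - c) * θ'), 0, e * (a + c)] =
      Matrix.of fun i j : Fin 3 => if i.val + j.val + 1 = 3 then (1 : R) else 0 := by
  ext i j
  fin_cases i <;> fin_cases j <;>
    simp [Matrix.mul_apply, Fin.sum_univ_three, Matrix.of_apply, map_add, map_sub, map_mul, map_neg, hσe, hσθ, hσθ'] <;> grind

/-- **Eigenframe of `t_θ`**: `t_θ · P_θ = P_θ · diag(a, b, c)` with `P_θ = (θ 0 θ; 0 1 0; −1 0 1)` — eigenvalue `a` on `(θ, 0, −1)`, `b` on `e₂`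
(the `U(1)`-slot), `c` on `(θ, 0, 1)`. [cite: Flicker1998UnitaryFL, §2 Prop. 3 pp. 78–79] -/
theorem flickerTorusElt_mul_frame {e θ θ' a b c : R} (h2 : 2 * e = 1) (hθ : θ * θ' = 1) :
    !![e * (a + c), 0, -(e * (a - c) * θ); 0, b, 0; -(e * (a - c) * θ'), 0, e * (a + c)] * !![θ, 0, θ; 0, 1, 0; -1, 0, 1] =
      !![θ, 0, θ; 0, 1, 0; -1, 0, 1] * !![a, 0, 0; 0, b, 0; 0, 0, c] := by
  ext i j
  fin_cases i <;> fin_cases j <;> simp [Matrix.mul_apply, Fin.sum_univ_three] <;> grind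

/-- **`t₁ ∈ U(σ, Φ₃)`** (`θ = 1`): `ᵗσ(t₁) Φ₃ t₁ = Φ₃` for `t₁ = (½(a+c) 0 −½(a−c); 0 b 0; −½(a−c) 0 ½(a+c)) = ι(g₁, b)`, an element of Flicker's
`H = Z_G(diag(1,−1,1))` (the pattern ★ `coe_endoGL_eq`). [cite: Flicker1998UnitaryFL, §2 Prop. 3 pp. 78–79] -/
theorem flickerTorusElt_one_unitary {e a b c : R} (h2 : 2 * e = 1) (hσe : σ e = e) (ha : σ a * a = 1) (hb : σ b * b = 1) (hc : σ c * c = 1) :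
    ((!![e * (a + c), 0, -(e * (a - c)); 0, b, 0; -(e * (a - c)), 0, e * (a + c)]).map σ)ᵀ *
        (Matrix.of fun i j : Fin 3 => if i.val + j.val + 1 = 3 then (1 : R) else 0) *
        !![e * (a + c), 0, -(e * (a - c)); 0, b, 0; -(e * (a - c)), 0, e * (a + c)] =
      Matrix.of fun i j : Fin 3 => if i.val + j.val + 1 = 3 then (1 : R) else 0 := by
  ext i j
  fin_cases i <;> fin_cases j <;>
    simp [Matrix.mul_apply, Fin.sum_univ_three, Matrix.of_apply, map_add, map_sub, map_mul, map_neg, hσe] <;> grind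

/-- **Eigenframe of `t₁`**: `t₁ · P₁ = P₁ · diag(a, b, c)`, `P₁ = (1 0 1; 0 1 0; −1 0 1)` (Flicker's `h⁻¹`-columns up to sign and scale).
[cite: Flicker1998UnitaryFL, §2 Prop. 3 pp. 78–79] -/
theorem flickerTorusElt_one_mul_frame {e a b c : R} (h2 : 2 * e = 1) :
    !![e * (a + c), 0, -(e * (a - c)); 0, b, 0; -(e * (a - c)), 0, e * (a + c)] * !![(1 : R), 0, 1; 0, 1, 0; -1, 0, 1] =
      !![(1 : R), 0, 1; 0, 1, 0; -1, 0, 1] * !![a, 0, 0; 0, b, 0; 0, 0, c] := by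
  ext i j
  fin_cases i <;> fin_cases j <;> simp [Matrix.mul_apply, Fin.sum_univ_three] <;> grind

/-- `!![a,0,0;0,b,0;0,0,c] = diagonal ![a, b, c]` (bridge to ★ `LocalStableClassesNonsplitTypeOneCount`'s `diagonal u`; Flicker's `T₀ = {diag(a,b,c)}`).
[cite: Flicker1998UnitaryFL, §2 Prop. 3 p. 78] -/
theorem etaDiag_eq_diagonal (a b c : R) : !![a, 0, 0; 0, b, 0; 0, 0, c] = diagonal ![a, b, c] := by
  ext i j
  fin_cases i <;> fin_cases j <;> rfl

/-- `det P_θ = 2θ`. [cite: Flicker1998UnitaryFL, §2 Prop. 3 p. 79] -/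
theorem det_flickerFrame (θ : R) : Matrix.det !![θ, 0, θ; 0, 1, 0; -1, 0, 1] = 2 * θ := by
  simp [Matrix.det_fin_three]; ring

/-- **Eigenvector lengths of the frame `P_θ`**: `ᵗσ(P_θ) Φ₃ P_θ = diag(−2θ, 1, 2θ)` (`σθ = θ`). [cite: Flicker1998UnitaryFL, §2 Prop. 3 p. 79]
[cite: Rogawski1990, §3.5 p. 29] -/
theorem twistGram_flickerFrame {θ : R} (hσθ : σ θ = θ) :
    twistGram σ (Matrix.of fun i j : Fin 3 => if i.val + j.val + 1 = 3 then (1 : R) else 0) !![θ, 0, θ; 0, 1, 0; -1, 0, 1] =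
      !![-(2 * θ), 0, 0; 0, 1, 0; 0, 0, 2 * θ] := by
  rw [twistGram_def]
  ext i j
  fin_cases i <;> fin_cases j <;>
    simp [Matrix.mul_apply, Fin.sum_univ_three, Matrix.of_apply, hσθ] <;> ring

/-- **`t_θ` is `diag(θ,1,1)`-conjugate to `t₁`**: `diag(θ,1,1) · t₁ = t_θ · diag(θ,1,1)` — the stable conjugator `r` of Flicker's `t₂ = r⁻¹ t₁ r`
(`θ = π`: a uniformiser of `F`, a non-norm). [cite: Flicker1998UnitaryFL, §2 Prop. 3 p. 79] -/
theorem diag_mul_flickerTorusElt_one {e θ θ' a b c : R} (hθ : θ * θ' = 1) :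
    !![θ, 0, 0; 0, 1, 0; 0, 0, 1] * !![e * (a + c), 0, -(e * (a - c)); 0, b, 0; -(e * (a - c)), 0, e * (a + c)] =
      !![e * (a + c), 0, -(e * (a - c) * θ); 0, b, 0; -(e * (a - c) * θ'), 0, e * (a + c)] * !![θ, 0, 0; 0, 1, 0; 0, 0, 1] := by
  ext i j
  fin_cases i <;> fin_cases j <;> simp [Matrix.mul_apply, Fin.sum_univ_three] <;> grind

/-- `diag(θ,1,1) · P₁ = P_θ`. [cite: Flicker1998UnitaryFL, §2 Prop. 3 p. 79] -/
theorem diag_mul_flickerFrame_one (θ : R) :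
    !![θ, 0, 0; 0, 1, 0; 0, 0, 1] * !![(1 : R), 0, 1; 0, 1, 0; -1, 0, 1] = !![θ, 0, θ; 0, 1, 0; -1, 0, 1] := by
  ext i j
  fin_cases i <;> fin_cases j <;> simp [Matrix.mul_apply, Fin.sum_univ_three]

/-- **`t₃ = t_π(a, c, b)` is `g₃`-conjugate to `t₁`**: `g₃ · t₁(a,b,c) = t_π(a,c,b) · g₃`, `g₃ = (½π π −½π; ½ 0 ½; −½ 1 ½)` (Flicker's `g₃`, p. 79, in
the `Φ₃`-frame: `g₃ = P₃ · P₁⁻¹`). [cite: Flicker1998UnitaryFL, §2 Prop. 3 p. 79] -/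
theorem gThree_mul_flickerTorusElt_one {e π π' a b c : R} (h2 : 2 * e = 1) (hπ : π * π' = 1) :
    !![e * π, π, -(e * π); e, 0, e; -e, 1, e] * !![e * (a + c), 0, -(e * (a - c)); 0, b, 0; -(e * (a - c)), 0, e * (a + c)] =
      !![e * (a + b), 0, -(e * (a - b) * π); 0, c, 0; -(e * (a - b) * π'), 0, e * (a + b)] * !![e * π, π, -(e * π); e, 0, e; -e, 1, e] := by
  ext i j
  fin_cases i <;> fin_cases j <;> simp [Matrix.mul_apply, Fin.sum_univ_three] <;> grind

/-- `g₃ · P₁ = P₃ = (π π 0; 0 0 1; −1 1 0)` — the eigenframe of `t₃` for the eigenvalues `(a, b, c)` (`b` now on `(π, 0, 1)`, `c` on `e₂`).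
[cite: Flicker1998UnitaryFL, §2 Prop. 3 p. 79] -/
theorem gThree_mul_flickerFrame_one {e π : R} (h2 : 2 * e = 1) :
    !![e * π, π, -(e * π); e, 0, e; -e, 1, e] * !![(1 : R), 0, 1; 0, 1, 0; -1, 0, 1] = !![π, π, 0; 0, 0, 1; -1, 1, 0] := by
  ext i j
  fin_cases i <;> fin_cases j <;> simp [Matrix.mul_apply, Fin.sum_univ_three] <;> grind

/-- `det g₃ = −π`. [cite: Flicker1998UnitaryFL, §2 Prop. 3 p. 79] -/
theorem det_gThree {e π : R} (h2 : 2 * e = 1) : Matrix.det !![e * π, π, -(e * π); e, 0, e; -e, 1, e] = -π := by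
  simp [Matrix.det_fin_three]; grind

/-- Eigenvector lengths of `P₃`: `diag(−2π, 2π, 1)`. [cite: Flicker1998UnitaryFL, §2 Prop. 3 p. 79] [cite: Rogawski1990, §3.5 p. 29] -/
theorem twistGram_frameThree {π : R} (hσπ : σ π = π) :
    twistGram σ (Matrix.of fun i j : Fin 3 => if i.val + j.val + 1 = 3 then (1 : R) else 0) !![π, π, 0; 0, 0, 1; -1, 1, 0] =
      !![-(2 * π), 0, 0; 0, 2 * π, 0; 0, 0, 1] := by
  rw [twistGram_def]
  ext i j
  fin_cases i <;> fin_cases j <;>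
    simp [Matrix.mul_apply, Fin.sum_univ_three, Matrix.of_apply, hσπ] <;> ring

/-- **`t₄ = t_π(b, a, c)` is `g₄`-conjugate to `t₁`**: `g₄ · t₁(a,b,c) = t_π(b,a,c) · g₄`, `g₄ = (½π π ½π; ½ 0 −½; ½ −1 ½) = P₄ · P₁⁻¹`.
[cite: Flicker1998UnitaryFL, §2 Prop. 3 p. 79] -/
theorem gFour_mul_flickerTorusElt_one {e π π' a b c : R} (h2 : 2 * e = 1) (hπ : π * π' = 1) :
    !![e * π, π, e * π; e, 0, -e; e, -1, e] * !![e * (a + c), 0, -(e * (a - c)); 0, b, 0; -(e * (a - c)), 0, e * (a + c)] =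
      !![e * (b + c), 0, -(e * (b - c) * π); 0, a, 0; -(e * (b - c) * π'), 0, e * (b + c)] * !![e * π, π, e * π; e, 0, -e; e, -1, e] := by
  ext i j
  fin_cases i <;> fin_cases j <;> simp [Matrix.mul_apply, Fin.sum_univ_three] <;> grind

/-- `g₄ · P₁ = P₄ = (0 π π; 1 0 0; 0 −1 1)` — the eigenframe of `t₄` for `(a, b, c)` (`a` on `e₂`, `b` on `(π, 0, −1)`).
[cite: Flicker1998UnitaryFL, §2 Prop. 3 p. 79] -/
theorem gFour_mul_flickerFrame_one {e π : R} (h2 : 2 * e = 1) :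
    !![e * π, π, e * π; e, 0, -e; e, -1, e] * !![(1 : R), 0, 1; 0, 1, 0; -1, 0, 1] = !![0, π, π; 1, 0, 0; 0, -1, 1] := by
  ext i j
  fin_cases i <;> fin_cases j <;> simp [Matrix.mul_apply, Fin.sum_univ_three] <;> grind

/-- `det g₄ = −π`. [cite: Flicker1998UnitaryFL, §2 Prop. 3 p. 79] -/
theorem det_gFour {e π : R} (h2 : 2 * e = 1) : Matrix.det !![e * π, π, e * π; e, 0, -e; e, -1, e] = -π := by
  simp [Matrix.det_fin_three]; grind

/-- Eigenvector lengths of `P₄`: `diag(1, −2π, 2π)`. [cite: Flicker1998UnitaryFL, §2 Prop. 3 p. 79] [cite: Rogawski1990, §3.5 p. 29] -/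
theorem twistGram_frameFour {π : R} (hσπ : σ π = π) :
    twistGram σ (Matrix.of fun i j : Fin 3 => if i.val + j.val + 1 = 3 then (1 : R) else 0) !![0, π, π; 1, 0, 0; 0, -1, 1] =
      !![1, 0, 0; 0, -(2 * π), 0; 0, 0, 2 * π] := by
  rw [twistGram_def]
  ext i j
  fin_cases i <;> fin_cases j <;>
    simp [Matrix.mul_apply, Fin.sum_univ_three, Matrix.of_apply, hσπ] <;> ring

/-- **`charpoly t_θ = (X − a)(X − b)(X − c)`** — so `t_θ(a,b,c)`, `t_θ(a,c,b)`, `t_θ(b,a,c)` all have the characteristic polynomial of `t₁` (stable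
conjugacy of regular semisimple elements of `U(3)` is `GL₃`-conjugacy, read on `charpoly`). From the eigenframe: `t_θ = P_θ · diag(a,b,c) · P_θ⁻¹`,
`det P_θ = 2θ` a unit. [cite: Flicker1998UnitaryFL, §2 Prop. 3 pp. 78–79] [cite: Rogawski1990, §3.1 p. 19] -/
theorem charpoly_flickerTorusElt {e θ θ' a b c : R} (h2 : 2 * e = 1) (hθ : θ * θ' = 1) :
    (!![e * (a + c), 0, -(e * (a - c) * θ); 0, b, 0; -(e * (a - c) * θ'), 0, e * (a + c)]).charpoly =
      (Polynomial.X - Polynomial.C a) * (Polynomial.X - Polynomial.C b) * (Polynomial.X - Polynomial.C c) := by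
  have hdet : IsUnit (Matrix.det !![θ, 0, θ; 0, 1, 0; -1, 0, 1]) := by
    rw [det_flickerFrame]
    exact IsUnit.of_mul_eq_one (e * θ') (by linear_combination θ * θ' * h2 + hθ)
  obtain ⟨P, hP⟩ := (Matrix.isUnit_iff_isUnit_det _).2 hdet
  have hframe := flickerTorusElt_mul_frame (a := a) (b := b) (c := c) h2 hθ
  rw [← hP] at hframe
  have ht : !![e * (a + c), 0, -(e * (a - c) * θ); 0, b, 0; -(e * (a - c) * θ'), 0, e * (a + c)] =
      P.val * !![a, 0, 0; 0, b, 0; 0, 0, c] * P.val⁻¹ := by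
    rw [← hframe, Matrix.mul_nonsing_inv_cancel_right _ _ ((Matrix.isUnit_iff_isUnit_det _).1 P.isUnit)]
  rw [ht, Matrix.charpoly_units_conj, etaDiag_eq_diagonal, Matrix.charpoly_diagonal, Fin.prod_univ_three]
  rfl

/-- **Isometries preserve eigenvector lengths**: `twistGram σ J (T P) = twistGram σ (ᵗσT J T) P` — so a frame `e γ′ = T γ′_w T⁻¹` with
`ᵗσT Φ₃ T = H′_w` (★ `exists_frame_of_nonsplit`) carries the sign vector of a `U(H′)`-class (★ `LocalStableClassesNonsplitKappaCount`) to that of its image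
in `U(Φ₃)` on the nose. [cite: Rogawski1990, §3.1 p. 19; §3.5 p. 29] -/
theorem twistGram_formCongr {n : Type*} [Fintype n] [DecidableEq n] (J : Matrix n n R) (T : GL n R) (P : Matrix n n R) :
    twistGram σ J (T.val * P) = twistGram σ (formCongr σ T J) P := by
  rw [twistGram_def, twistGram_def, formCongr, Matrix.map_mul, Matrix.transpose_mul]
  simp only [Matrix.mul_assoc]

end Ring

/-! ## §2 The sign vectors over a field: which eigenvector lengths differ from those of `t₁` by a NORM (`π ∉ N`, `±2 ∈ N`) -/

section Field

variable {K : Type*} [Field K] (σ : K →+* K)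

/-- Norms form a group: `σ(z x⁻¹)(z x⁻¹) = σ(z) z · (σ(x) x)⁻¹`. [folklore] -/
private theorem norm_mul_inv (x z : K) : σ (z * x⁻¹) * (z * x⁻¹) = σ z * z * (σ x * x)⁻¹ := by
  rw [map_mul, map_inv₀, mul_inv]
  ring

/-- From `σ(z) z · u = π · u` with `u = σ(x) x ≠ 0`... in the shape met below: if `σ(z) z · s = π · (σ(x) x) · s`-free form
`σ(z) z = π · (σ x * x)` then `π = σ(z x⁻¹)(z x⁻¹)`. [folklore] -/
private theorem exists_norm_of_eq_mul {x z π : K} (hx0 : σ x * x ≠ 0) (h : σ z * z = π * (σ x * x)) : σ (z * x⁻¹) * (z * x⁻¹) = π := by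
  rw [norm_mul_inv, h, mul_assoc, mul_inv_cancel₀ hx0, mul_one]

/-- **Sign vector of `t₁` relative to itself: `(0, 0, 0)`** (all three length ratios are `1 = σ(1)·1`). [cite: Rogawski1990, §3.5 Prop. 3.5.2 (a) p. 29] -/
theorem normTest_flickerFrame_one_iff (P₁ : Matrix (Fin 3) (Fin 3) K) (i : Fin 3) :
    (∃ z : K, IsUnit z ∧
        twistGram σ (Matrix.of fun i j : Fin 3 => if i.val + j.val + 1 = 3 then (1 : K) else 0) P₁ i i =
          σ z * z * twistGram σ (Matrix.of fun i j : Fin 3 => if i.val + j.val + 1 = 3 then (1 : K) else 0) P₁ i i) ↔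
      (![0, 0, 0] : Fin 3 → ZMod 2) i = 0 := by
  refine ⟨fun _ => by fin_cases i <;> rfl, fun _ => ⟨1, isUnit_one, by rw [map_one, one_mul, one_mul]⟩⟩

/-- **Sign vector of `t₂ = t_π` relative to `t₁`: `(1, 0, 1)`** — the frame `P_π = diag(π,1,1) P₁` has lengths `(−2π, 1, 2π)` against `(−2, 1, 2)`;
`π` (a uniformiser of `F`) is not a norm. [cite: Flicker1998UnitaryFL, §2 Prop. 3 p. 79] [cite: Rogawski1990, §3.5 Prop. 3.5.2 (a) p. 29; §3.6 p. 31] -/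
theorem normTest_flickerFrame_pi_iff {π : K} (hσπ : σ π = π) (hπN : ∀ z : K, σ z * z ≠ π) (h2 : (2 : K) ≠ 0) (i : Fin 3) :
    (∃ z : K, IsUnit z ∧
        twistGram σ (Matrix.of fun i j : Fin 3 => if i.val + j.val + 1 = 3 then (1 : K) else 0) !![π, 0, π; 0, 1, 0; -1, 0, 1] i i =
          σ z * z * twistGram σ (Matrix.of fun i j : Fin 3 => if i.val + j.val + 1 = 3 then (1 : K) else 0) !![(1 : K), 0, 1; 0, 1, 0; -1, 0, 1] i i) ↔
      (![1, 0, 1] : Fin 3 → ZMod 2) i = 0 := by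
  rw [twistGram_flickerFrame σ hσπ, twistGram_flickerFrame σ (map_one σ)]
  fin_cases i
  · refine ⟨fun ⟨z, _, hz⟩ => absurd ?_ (hπN z), fun h => absurd h (by decide)⟩
    have hz' : -(2 * π) = σ z * z * -(2 * 1) := hz
    have h' : σ z * z * 2 = π * 2 := by linear_combination hz'
    exact mul_right_cancel₀ h2 h'
  · exact ⟨fun _ => rfl, fun _ => ⟨1, isUnit_one, by rw [map_one, one_mul, one_mul]; rfl⟩⟩
  · refine ⟨fun ⟨z, _, hz⟩ => absurd ?_ (hπN z), fun h => absurd h (by decide)⟩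
    have hz' : 2 * π = σ z * z * (2 * 1) := hz
    have h' : σ z * z * 2 = π * 2 := by linear_combination -hz'
    exact mul_right_cancel₀ h2 h'

/-- **Sign vector of `t₃ = t_π(a,c,b)` relative to `t₁`: `(1, 1, 0)`** — frame `P₃ = g₃ P₁`, lengths `(−2π, 2π, 1)` against `(−2, 1, 2)`: ratios `π`, `2π`,
`½`; `2 = σ(x) x` is a norm (Flicker's `x`, `E∕F` unramified), `π` is not. [cite: Flicker1998UnitaryFL, §2 Prop. 3 p. 79]
[cite: Rogawski1990, §3.5 Prop. 3.5.2 (a) p. 29; §3.6 p. 31] -/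
theorem normTest_frameThree_iff {π x : K} (hσπ : σ π = π) (hπN : ∀ z : K, σ z * z ≠ π) (hx : σ x * x = 2) (h2 : (2 : K) ≠ 0) (i : Fin 3) :
    (∃ z : K, IsUnit z ∧
        twistGram σ (Matrix.of fun i j : Fin 3 => if i.val + j.val + 1 = 3 then (1 : K) else 0) !![π, π, 0; 0, 0, 1; -1, 1, 0] i i =
          σ z * z * twistGram σ (Matrix.of fun i j : Fin 3 => if i.val + j.val + 1 = 3 then (1 : K) else 0) !![(1 : K), 0, 1; 0, 1, 0; -1, 0, 1] i i) ↔
      (![1, 1, 0] : Fin 3 → ZMod 2) i = 0 := by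
  have hx0 : σ x * x ≠ 0 := by rw [hx]; exact h2
  have hxu : IsUnit x := isUnit_iff_ne_zero.2 (by rintro rfl; exact hx0 (by rw [mul_zero]))
  rw [twistGram_frameThree σ hσπ, twistGram_flickerFrame σ (map_one σ)]
  fin_cases i
  · refine ⟨fun ⟨z, _, hz⟩ => absurd ?_ (hπN z), fun h => absurd h (by decide)⟩
    have hz' : -(2 * π) = σ z * z * -(2 * 1) := hz
    have h' : σ z * z * 2 = π * 2 := by linear_combination hz'
    exact mul_right_cancel₀ h2 h'
  · refine ⟨fun ⟨z, _, hz⟩ => absurd (exists_norm_of_eq_mul σ hx0 ?_) (hπN (z * x⁻¹)), fun h => absurd h (by decide)⟩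
    have hz' : 2 * π = σ z * z * 1 := hz
    linear_combination -hz' - π * hx
  · refine ⟨fun _ => rfl, fun _ => ⟨x⁻¹, isUnit_iff_ne_zero.2 (inv_ne_zero hxu.ne_zero), ?_⟩⟩
    have hz' : (1 : K) = σ x⁻¹ * x⁻¹ * (2 * 1) := by
      rw [map_inv₀, mul_one, ← mul_inv, hx, inv_mul_cancel₀ h2]
    exact hz'

/-- **Sign vector of `t₄ = t_π(b,a,c)` relative to `t₁`: `(0, 1, 1)`** — frame `P₄ = g₄ P₁`, lengths `(1, −2π, 2π)` against `(−2, 1, 2)`: ratios `−½`,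
`−2π`, `π`; `−2 = σ(y) y` is a norm (Flicker's `y`), `π` is not. [cite: Flicker1998UnitaryFL, §2 Prop. 3 p. 79]
[cite: Rogawski1990, §3.5 Prop. 3.5.2 (a) p. 29; §3.6 p. 31] -/
theorem normTest_frameFour_iff {π y : K} (hσπ : σ π = π) (hπN : ∀ z : K, σ z * z ≠ π) (hy : σ y * y = -2) (h2 : (2 : K) ≠ 0) (i : Fin 3) :
    (∃ z : K, IsUnit z ∧
        twistGram σ (Matrix.of fun i j : Fin 3 => if i.val + j.val + 1 = 3 then (1 : K) else 0) !![0, π, π; 1, 0, 0; 0, -1, 1] i i =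
          σ z * z * twistGram σ (Matrix.of fun i j : Fin 3 => if i.val + j.val + 1 = 3 then (1 : K) else 0) !![(1 : K), 0, 1; 0, 1, 0; -1, 0, 1] i i) ↔
      (![0, 1, 1] : Fin 3 → ZMod 2) i = 0 := by
  have hm2 : (-2 : K) ≠ 0 := neg_ne_zero.2 h2
  have hy0 : σ y * y ≠ 0 := by rw [hy]; exact hm2
  have hyu : IsUnit y := isUnit_iff_ne_zero.2 (by rintro rfl; exact hy0 (by rw [mul_zero]))
  rw [twistGram_frameFour σ hσπ, twistGram_flickerFrame σ (map_one σ)]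
  fin_cases i
  · refine ⟨fun _ => rfl, fun _ => ⟨y⁻¹, isUnit_iff_ne_zero.2 (inv_ne_zero hyu.ne_zero), ?_⟩⟩
    have hz' : (1 : K) = σ y⁻¹ * y⁻¹ * -(2 * 1) := by
      rw [map_inv₀, mul_one, ← mul_inv, hy]
      field_simp
    exact hz'
  · refine ⟨fun ⟨z, _, hz⟩ => absurd (exists_norm_of_eq_mul σ hy0 ?_) (hπN (z * y⁻¹)), fun h => absurd h (by decide)⟩
    have hz' : -(2 * π) = σ z * z * 1 := hz
    linear_combination -hz' - π * hy
  · refine ⟨fun ⟨z, _, hz⟩ => absurd ?_ (hπN z), fun h => absurd h (by decide)⟩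
    have hz' : 2 * π = σ z * z * (2 * 1) := hz
    have h' : σ z * z * 2 = π * 2 := by linear_combination -hz'
    exact mul_right_cancel₀ h2 h'

end Field

/-! ## §3 (appended) The radial conjugators `r = diag(u, 1, u′)` of Flicker's Prop. 6 / Cor. 9 (`u = ϖ^{−i}`, `u u′ = 1`) -/

section Radial

variable {R : Type*} [CommRing R]

/-- **`diag(u,1,u′) · t_θ = t_{θu², θ′u′²} · diag(u,1,u′)`** (`u u′ = 1`): conjugating Flicker's `t_θ` by the radial element
`r = ι(diag(u, u′), 1) = diag(u, 1, u′)` of `H` (Prop. 6: `r_θ^j = diag(π^{−(j−θ̄)∕2}, π^{(j−θ̄)∕2})` on the `U(1,1)`-block) rescales `θ` by `u²` —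
the shape met in Cor. 9's integrand `(r_θ^j)⁻¹ t_θ r_θ^j`. [cite: Flicker1998UnitaryFL, §3 Prop. 6 p. 83, Cor. 9 p. 85] -/
theorem diagRadial_mul_flickerTorusElt {e θ θ' u u' a b c : R} (hu : u * u' = 1) :
    !![u, 0, 0; 0, 1, 0; 0, 0, u'] * !![e * (a + c), 0, -(e * (a - c) * θ); 0, b, 0; -(e * (a - c) * θ'), 0, e * (a + c)] =
      !![e * (a + c), 0, -(e * (a - c) * (θ * u * u)); 0, b, 0; -(e * (a - c) * (θ' * u' * u')), 0, e * (a + c)] *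
        !![u, 0, 0; 0, 1, 0; 0, 0, u'] := by
  ext i j
  fin_cases i <;> fin_cases j <;> simp [Matrix.mul_apply, Fin.sum_univ_three] <;> grind

/-- `diag(u,1,u′) · diag(u′,1,u) = 1` (`u u′ = 1`): the radial element is invertible with the displayed inverse.
[cite: Flicker1998UnitaryFL, §3 Prop. 6 p. 83] -/
theorem diagRadial_mul_diagRadial_inv {u u' : R} (hu : u * u' = 1) :
    !![u, 0, 0; 0, 1, 0; 0, 0, u'] * !![u', 0, 0; 0, 1, 0; 0, 0, u] = 1 := by
  ext i j
  fin_cases i <;> fin_cases j <;> simp [Matrix.mul_apply, Fin.sum_univ_three] <;> grind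

/-- The radial element preserves `Φ₃`: `ᵗσ(diag(u,1,u′)) Φ₃ diag(u,1,u′) = Φ₃` when `σ(u) u′ = 1` (e.g. `u = ϖ^{−i}` `σ`-fixed, `u′ = ϖ^{i}`) — so
`r ∈ U(σ, Φ₃)` (indeed `r ∈ H = ι(U(Φ₂) × U(Φ₁))`). [cite: Flicker1998UnitaryFL, §3 Prop. 6 p. 83] -/
theorem diagRadial_unitary (σ : R →+* R) {u u' : R} (hσu : σ u * u' = 1) (hσu' : σ u' * u = 1) :
    ((!![u, 0, 0; 0, 1, 0; 0, 0, u']).map σ)ᵀ * (Matrix.of fun i j : Fin 3 => if i.val + j.val + 1 = 3 then (1 : R) else 0) *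
        !![u, 0, 0; 0, 1, 0; 0, 0, u'] =
      Matrix.of fun i j : Fin 3 => if i.val + j.val + 1 = 3 then (1 : R) else 0 := by
  ext i j
  fin_cases i <;> fin_cases j <;>
    simp [Matrix.mul_apply, Fin.sum_univ_three, Matrix.of_apply] <;> grind

end Radial

/-! ## §4 (appended) The torus elements centralise Flicker's `c = diag(1, −1, 1)` (the `ht : t ∈ Z(c)` input of the unfolding ★ Prop. 5) -/

section Central

variable {R : Type*} [CommRing R]

/-- **`diag(1,−1,1) · t_θ = t_θ · diag(1,−1,1)`**: Flicker's torus elements lie in `H = Z_G(diag(1,−1,1))` (the pattern `(∗ 0 ∗; 0 ∗ 0; ∗ 0 ∗)`).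
[cite: Flicker1998UnitaryFL, §2 Prop. 3 p. 78; §3 p. 80] -/
theorem signDiagonal_mul_flickerTorusElt (e θ θ' a b c : R) :
    !![(1 : R), 0, 0; 0, -1, 0; 0, 0, 1] * !![e * (a + c), 0, -(e * (a - c) * θ); 0, b, 0; -(e * (a - c) * θ'), 0, e * (a + c)] =
      !![e * (a + c), 0, -(e * (a - c) * θ); 0, b, 0; -(e * (a - c) * θ'), 0, e * (a + c)] * !![(1 : R), 0, 0; 0, -1, 0; 0, 0, 1] := by
  ext i j
  fin_cases i <;> fin_cases j <;> simp [Matrix.mul_apply, Fin.sum_univ_three]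

/-- The same for `t₁` (`θ = θ′ = 1`, literal-free middle sign). [cite: Flicker1998UnitaryFL, §2 Prop. 3 p. 78] -/
theorem signDiagonal_mul_flickerTorusElt_one (e a b c : R) :
    !![(1 : R), 0, 0; 0, -1, 0; 0, 0, 1] * !![e * (a + c), 0, -(e * (a - c)); 0, b, 0; -(e * (a - c)), 0, e * (a + c)] =
      !![e * (a + c), 0, -(e * (a - c)); 0, b, 0; -(e * (a - c)), 0, e * (a + c)] * !![(1 : R), 0, 0; 0, -1, 0; 0, 0, 1] := by
  ext i j
  fin_cases i <;> fin_cases j <;> simp [Matrix.mul_apply, Fin.sum_univ_three]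

end Central

end Literature.NumberTheory.Rogawski1990
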